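import Mathlib
import Summits.Ventures.DiscreteObjects.Mahler.Height1CensusCells

/-!
# The height-1 sub-Lehmer statement up to a degree `N ≤ 60`, and the cells each degree needs
(venture `DiscreteObjects`, target L)

Cell `pub-namedobj`, seat `pub-namedobj-mahler` (gen 6). Framing: lottery ticket; floor = certified
bounds/negative ranges.

`Height1SubLehmerEmptyUpTo N` := "no integer polynomial of degree `≤ N` with coefficients in
`{-1, 0, 1}` is sub-Lehmer" — the TYPED headline of the cell's height-1 ladder, one statement per rung
`N = 56, 57, 58, 59, 60` (none is proved here; each is decided by census runs, human-gated).  Kernel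
content: the rung `N` follows (conditional on [MRW08, Thm 1.1] and Smyth's theorem) from the cells
`Height1Cell s d` with `Σ φ(s) + d ≤ N` only (`height1SubLehmerEmptyUpTo_of_cells`): degree `≤ 56` needs
the single cell `(∅, 56)` (= family L6c), `≤ 57` three cells, `≤ 58` ten, `≤ 59` twenty-two, `≤ 60` all
fifty-three (cumulative counts; file `CELLS-L60.md`); the rungs are monotone (`height1SubLehmerEmptyUpTo_mono`) and
equivalent to the census rows `HeightBoundedCensus n 1 M(L) []`, `n ≤ N`
(`height1SubLehmerEmptyUpTo_iff_census`).
-/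

namespace Summit.Ventures.DiscreteObjects.Mahler

open Polynomial Literature.NumberTheory.MahlerMeasure

/-- **Rung `N` of the height-1 ladder (typed):** no integer polynomial of degree `≤ N` and height `≤ 1`
is sub-Lehmer. -/
def Height1SubLehmerEmptyUpTo (N : ℕ) : Prop :=
  ∀ P : ℤ[X], P.natDegree ≤ N → height P ≤ 1 → ¬ SubLehmer P

/-- The rungs are monotone in `N`. -/
theorem height1SubLehmerEmptyUpTo_mono {M N : ℕ} (hMN : M ≤ N) (h : Height1SubLehmerEmptyUpTo N) :
    Height1SubLehmerEmptyUpTo M :=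
  fun P hdeg hh => h P (le_trans hdeg hMN) hh

/-- Rung `N` is the conjunction of the census rows `(n, 1, M(L))` with empty witness list, `n ≤ N`. -/
theorem height1SubLehmerEmptyUpTo_iff_census (N : ℕ) :
    Height1SubLehmerEmptyUpTo N ↔ ∀ n ≤ N, HeightBoundedCensus n 1 (intMahlerMeasure lehmerPoly) [] := by
  constructor
  · intro h n hn
    rw [heightBoundedCensus_nil_iff]
    intro p hdeg hh h1 hlt
    exact h p (by omega) hh ⟨h1, hlt⟩
  · intro h P hdeg hh hP
    have := (heightBoundedCensus_nil_iff P.natDegree 1 (intMahlerMeasure lehmerPoly)).mp (h P.natDegree hdeg)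
      P rfl hh hP.1
    exact this hP.2

/-- Below degree `56` every rung holds outright (the published floor [MRW08, Thm 1.1], as a named fact). -/
theorem height1SubLehmerEmptyUpTo_of_lt_56 (h : SubLehmerDegreeBound) {N : ℕ} (hN : N < 56) :
    Height1SubLehmerEmptyUpTo N := by
  intro P hdeg _ hP
  have := natDegree_ge_of_subLehmer h hP
  omega

/-- **Assembly of rung `N ≤ 60` from its own cells (kernel):** conditional on [MRW08, Thm 1.1] and
Smyth's theorem, the cells `Height1Cell s d` with `(s, d)` admissible AND `Σ φ(s) + d ≤ N` imply rung `N`.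
(So degree `≤ 57` needs the two cells of total degree `≤ 57`, etc.; cells of total degree `> N` are
not needed for rung `N`.) -/
theorem height1SubLehmerEmptyUpTo_of_cells (h : SubLehmerDegreeBound) (hS : NonreciprocalMahlerBound)
    {N : ℕ} (hN : N ≤ 60)
    (hcells : ∀ (s : Multiset ℕ) (d : ℕ), AdmissibleCell s d → (s.map Nat.totient).sum + d ≤ N →
      Height1Cell s d) :
    Height1SubLehmerEmptyUpTo N := by
  intro P hdeg hh hP
  obtain ⟨u, a, s, Q, hu, hs, hPf, hQirr, hQ, _, hrev, hQd, hc0, hncyc, hdegs, _⟩ :=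
    subLehmer_degree_le_60_structure h hS hP (le_trans hdeg hN)
  have hadm : AdmissibleCell s Q.natDegree := ⟨hs, hQd, by omega⟩
  have hhR : height ((s.map fun m => cyclotomic m ℤ).prod * Q) ≤ 1 := by
    rw [← height_signed_shift hu a, ← mul_assoc, ← hPf]; exact hh
  exact hcells s Q.natDegree hadm (by omega) Q rfl hQirr hrev hc0 hncyc hhR hQ

/-- Rung `60` from all admissible cells (restatement of `height1_subLehmer_empty_le_60_of_cells`). -/
theorem height1SubLehmerEmptyUpTo_60_of_cells (h : SubLehmerDegreeBound) (hS : NonreciprocalMahlerBound)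
    (hcells : ∀ (s : Multiset ℕ) (d : ℕ), AdmissibleCell s d → Height1Cell s d) :
    Height1SubLehmerEmptyUpTo 60 :=
  height1_subLehmer_empty_le_60_of_cells h hS hcells

/-- Rung `56` is exactly the L6 headline statement plus the published floor below `56`. -/
theorem height1SubLehmerEmptyUpTo_56_iff (h : SubLehmerDegreeBound) :
    Height1SubLehmerEmptyUpTo 56 ↔ Height1Degree56SubLehmerEmpty := by
  rw [height1Degree56SubLehmerEmpty_iff]
  constructor
  · intro h56 p hdeg hh; exact h56 p (le_of_eq hdeg) hh
  · intro h56 P hdeg hh hP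
    rcases Nat.lt_or_ge P.natDegree 56 with hlt | hge
    · exact height1SubLehmerEmptyUpTo_of_lt_56 h hlt P le_rfl hh hP
    · exact h56 P (by omega) hh hP

end Summit.Ventures.DiscreteObjects.Mahler
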